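import Literature.MathematicalPhysics.QuantumFieldTheory.Borinsky2020.HeppSectorCoordinates
import Literature.Probability.Distributions.GaussianPiDensity
import HarnessLib

/-!
# The Hepp-sector integral of a monomial «converges precisely when» all chain partial sums are positive (Panzer, AIHPD 10 (2023) 31, §2.2 p. 42, the sentence before Proposition 2.9) — PROVED, both directions, as a statement about the extended integral `∫⁻`

Companion of `Borinsky2020/HeppSectorCoordinates.lean` (same folder, same vocabulary: the fundamental Hepp sector in the affine
chart `heppCube m = {a | 0 < a_0 ≤ a_1 ≤ ⋯ ≤ a_m ≤ 1}`, the sector variables `heppMap`, the unit box `heppUnitBox m = (0,1]^{m+1}`,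
the Jacobian `∏_k β_k^k`), which PROVES the convergent half with its value — `integral_heppCube_monomial`:
`∫_{heppCube} ∏_l a_l^{s_l − 1} da = ∏_k (Σ_{l≤k} s_l)⁻¹` under the hypothesis that every partial sum `S_k = Σ_{l≤k} s_l` is positive.
This file types the word «precisely» of the source: the DIVERGENT half (`S_k ≤ 0` for some `k` ⇒ the sector integral of the
(positive) monomial is `+∞`) and the resulting equivalence, which is the per-sector form of the power-counting criterion every
Hepp-sector statement of the pub-qed TROPICAL track reads off an «exponent table» (one real exponent `S_k` per nested chain set
`{0,…,k}` of the sector; integrable iff all of them are positive).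

Source [Panzer2022]: E. Panzer, "Hepp's bound for Feynman graphs and matroids", Ann. Inst. Henri Poincaré D 10 (2023) 31–119,
doi:10.4171/aihpd/126 = arXiv:1908.09820 (e-print `hepp.tex` deposited on the pub-qed HOME, `data/lit/sources/.cache/1908.09820/`,
tex l.476–491; journal page texts `…/journal-pdf-pages/AIHPD10-31-Panzer2023/p0012.txt` = p. 42), VERBATIM: "In the affine chart
x_{σ(N)} = 1, the integral over a Hepp sector can therefore be written as ∫_{0<x_{σ(1)}<⋯<x_{σ(N)}=1} ∏_{k=1}^{N−1}
x_{σ(k)}^{a_{σ(k)}−1−(D/2)(loops(G^σ_k)−loops(G^σ_{k−1}))} dx_{σ(k)}. Changing variables to y_k = x_{σ(k)}/x_{σ(k+1)}, this evaluates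
to the summand in (multi-hepp-from-sectors): ∏ ∫_0^1 y_k^{(Σ_{i=1}^k a_{σ(i)})−1−(D/2) loops(G^σ_k)} dy_k = 1/(sdc(G^σ_1)⋯sdc(G^σ_{N−1})).
**This integral converges precisely when all real parts Re sdc(G^σ_1), …, Re sdc(G^σ_{N−1}) > 0 are positive.** We can summarize
this calculation as follows: Proposition [2.9]. The Mellin integrals (hepp-mellin) and (period-mellin) converge precisely for those
indices a ⊂ ℂ^N whose real part lies in the open convex polyhedral cone Λ := ⋂_{∅≠γ⊊G} {a ∈ ℝ^N : sdc_a(γ) > 0} ⊆ ℝ^N." and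
(l.499) "The characterization of the convergence of Feynman integrals in terms of *power counting* conditions sdc(γ) > 0 is
fundamental for renormalization in physics [Dyson, Weinberg]."  (The same evaluation, read as a sampling density, is Volkov,
Phys. Rev. D 96 (2017) 096018 §III.C — typed in `Volkov2017/SectorIntegral.lean` — with the printed standing hypothesis "Deg(s) > 0",
§III.B (16).)

TYPING (as in the companion file; REAL exponents — the source allows complex indices and states the criterion on their real parts;
TODO(general form): complex `s` with `‖·‖`, same proofs on `Re s`): exponent vector `s : Fin (m + 1) → ℝ` (so the monomial is
`∏_l a_l^{s_l − 1}`, Panzer's `x^{a−1}` convention), chain partial sums `Σ_{l ∈ Iic k} s l` (Panzer's `sdc(G^σ_k)` once `s` carries the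
graph-theoretic shifts; here arbitrary reals, exactly as in `integral_heppCube_monomial`). Because a divergent integral has no Bochner
value, the criterion is stated for the lower Lebesgue integral `∫⁻` of the (nonnegative) monomial, and, equivalently, as
`IntegrableOn`. PROVED (Mathlib + the companion file + the tree's finite-product Tonelli
`Literature.Probability.Distributions.lintegral_fin_nat_prod_eq_prod`):
* `lintegral_heppCube_eq_lintegral_heppUnitBox` — the `∫⁻` form of the companion's change of variables onto `(0,1]^{m+1}`;
* `lintegral_heppCube_monomial_eq_prod` — "this evaluates to ∏_k ∫_0^1 y_k^{S_k − 1} dy_k" (no hypothesis on `s`);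
* `lintegral_unitIoc_rpow_sub_one_of_pos` / `lintegral_unitIoc_rpow_sub_one_eq_top` — `∫_0^1 y^{c−1} dy = 1/c` for `c > 0` and `= +∞`
  for `c ≤ 0` (the latter from Mathlib's `intervalIntegral.integrableOn_Ioo_rpow_iff`);
* `lintegral_heppCube_monomial` — all `S_k > 0` ⇒ `∫⁻ = ofReal (∏_k S_k⁻¹)` (the printed value, `∫⁻` form);
* **`lintegral_heppCube_monomial_eq_top`** — some `S_k ≤ 0` ⇒ `∫⁻_{heppCube} ∏_l a_l^{s_l−1} = ∞`;
* **`lintegral_heppCube_monomial_lt_top_iff`**, **`integrableOn_heppCube_monomial_iff`** — "converges precisely when all … > 0".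
NOT typed: the sum over all sectors / the cone Λ of Proposition 2.9 as an intersection over subgraphs (that bookkeeping — which chain
sets occur and what their exponents are for a GRAPH — is `HeppBound.lean` / `HeppBoundFlagFormula.lean`; here one sector, arbitrary
real exponents), complex indices. (Filed by the pub-qed TROPICAL literature seat `pub-qed-trop-lit` gen 17 as the kernel object behind
the track's per-sector exponent criterion, `tropical/lit/SOURCES.md` §1.7 / A11; VALUE-FREE: an equivalence about elementary integrals,
nothing per graph or word. independent recomputation; certified where stated, statistical where stated; no new-physics claim.)
-/

namespace Literature.MathematicalPhysics.QuantumFieldTheory.Borinsky2020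

open MeasureTheory Set Real
open scoped ENNReal

variable {m : ℕ}

/-! ### One-dimensional pieces: `∫_0^1 y^{c-1} dy` -/

/-- `∫⁻_{(0,1]} y^{c−1} dy = 1/c` for `c > 0` ("∫_0^1 y_k^{(Σ_{i≤k} a_{σ(i)})−1−…} dy_k = 1/sdc(G^σ_k)", one factor).
[cite: Panzer2022, §2.2 p. 42 (display before Proposition 2.9)] -/
theorem lintegral_unitIoc_rpow_sub_one_of_pos {c : ℝ} (hc : 0 < c) :
    ∫⁻ y in Ioc (0 : ℝ) 1, ENNReal.ofReal (y ^ (c - 1)) = ENNReal.ofReal c⁻¹ := by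
  have hint : IntegrableOn (fun t : ℝ => t ^ (c - 1)) (Ioc 0 1) :=
    (intervalIntegrable_iff_integrableOn_Ioc_of_le zero_le_one).1
      (intervalIntegral.intervalIntegrable_rpow' (by linarith))
  rw [← ofReal_integral_eq_lintegral_ofReal hint ((ae_restrict_iff' measurableSet_Ioc).2
      (ae_of_all _ fun t ht => Real.rpow_nonneg ht.1.le _)),
    ← intervalIntegral.integral_of_le zero_le_one, integral_rpow (Or.inl (by linarith)), sub_add_cancel,
    Real.one_rpow, Real.zero_rpow hc.ne', sub_zero, one_div]

/-- `∫⁻_{(0,1]} y^{c−1} dy = +∞` for `c ≤ 0` — the divergent factor ("converges precisely when … > 0": the power `y^s` is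
integrable at `0` iff `s > −1`, Mathlib's `intervalIntegral.integrableOn_Ioo_rpow_iff`). [cite: Panzer2022, §2.2 p. 42 (sentence before Proposition 2.9)] -/
theorem lintegral_unitIoc_rpow_sub_one_eq_top {c : ℝ} (hc : c ≤ 0) :
    ∫⁻ y in Ioc (0 : ℝ) 1, ENNReal.ofReal (y ^ (c - 1)) = ∞ := by
  by_contra h
  have hmeas : AEStronglyMeasurable (fun y : ℝ => y ^ (c - 1)) (volume.restrict (Ioc 0 1)) :=
    (measurable_id.pow_const _).aestronglyMeasurable
  have hfin : HasFiniteIntegral (fun y : ℝ => y ^ (c - 1)) (volume.restrict (Ioc 0 1)) := by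
    rw [hasFiniteIntegral_iff_ofReal ((ae_restrict_iff' measurableSet_Ioc).2
      (ae_of_all _ fun t ht => Real.rpow_nonneg ht.1.le _))]
    exact Ne.lt_top h
  have hint : IntegrableOn (fun y : ℝ => y ^ (c - 1)) (Ioc 0 1) := ⟨hmeas, hfin⟩
  have h' := (intervalIntegral.integrableOn_Ioo_rpow_iff zero_lt_one).1 (hint.mono_set Ioo_subset_Ioc_self)
  linarith

/-! ### The sector integral as a product of one-dimensional integrals -/

/-- The `∫⁻` form of Hepp's change of variables in the affine chart (companion of `integral_heppCube_eq_integral_heppUnitBox`):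
`∫⁻_{0 < a_0 ≤ ⋯ ≤ a_m ≤ 1} g(a) da = ∫⁻_{(0,1]^{m+1}} (∏_k β_k^k) · g(heppMap β) dβ`, no integrability needed.
[cite: Panzer2022, §2.2 p. 42 (changing variables to y_k = x_{σ(k)}/x_{σ(k+1)})] -/
theorem lintegral_heppCube_eq_lintegral_heppUnitBox (g : (Fin (m + 1) → ℝ) → ℝ≥0∞) :
    ∫⁻ a in heppCube m, g a =
      ∫⁻ β in heppUnitBox m, ENNReal.ofReal (∏ k : Fin (m + 1), β k ^ (k : ℕ)) * g (heppMap β) := by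
  rw [← image_heppMap_heppUnitBox,
    lintegral_image_eq_lintegral_abs_det_fderiv_mul volume measurableSet_heppUnitBox
      (fun β _ => (hasFDerivAt_heppMap β).hasFDerivWithinAt) (injOn_heppMap.mono heppUnitBox_subset_heppBox) g]
  refine setLIntegral_congr_fun measurableSet_heppUnitBox fun β hβ => ?_
  rw [abs_of_pos (det_heppDeriv_pos fun j => (hβ j).1), det_heppDeriv]

/-- "Changing variables to y_k = x_{σ(k)}/x_{σ(k+1)}, this evaluates to ∏_k ∫_0^1 y_k^{S_k − 1} dy_k" — for EVERY real exponent
vector (no positivity assumed): the `∫⁻` of the sector monomial is the product of the one-dimensional `∫⁻`'s with the chain partial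
sums `S_k = Σ_{l≤k} s_l`. [cite: Panzer2022, §2.2 p. 42 (display before Proposition 2.9)] -/
theorem lintegral_heppCube_monomial_eq_prod (s : Fin (m + 1) → ℝ) :
    ∫⁻ a in heppCube m, ENNReal.ofReal (∏ l, a l ^ (s l - 1)) =
      ∏ k : Fin (m + 1), ∫⁻ y in Ioc (0 : ℝ) 1, ENNReal.ofReal (y ^ ((∑ l ∈ Finset.Iic k, s l) - 1)) := by
  rw [lintegral_heppCube_eq_lintegral_heppUnitBox]
  have hcongr : ∀ β ∈ heppUnitBox m,
      ENNReal.ofReal (∏ k : Fin (m + 1), β k ^ (k : ℕ)) * ENNReal.ofReal (∏ l, heppMap β l ^ (s l - 1)) =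
        ∏ k : Fin (m + 1), ENNReal.ofReal (β k ^ ((∑ l ∈ Finset.Iic k, s l) - 1)) := by
    intro β hβ
    have hpos : ∀ j, 0 < β j := fun j => (hβ j).1
    rw [← ENNReal.ofReal_mul (Finset.prod_nonneg fun k _ => pow_nonneg (hpos k).le _),
      jacobian_mul_prod_heppMap_rpow hpos s,
      ENNReal.ofReal_prod_of_nonneg fun k _ => Real.rpow_nonneg (hpos k).le _]
  rw [setLIntegral_congr_fun measurableSet_heppUnitBox hcongr, heppUnitBox_eq_pi, volume_pi, Measure.restrict_pi_pi]
  exact Literature.Probability.Distributions.lintegral_fin_nat_prod_eq_prod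
    (fun _ : Fin (m + 1) => (volume : Measure ℝ).restrict (Ioc 0 1))
    (fun (k : Fin (m + 1)) (y : ℝ) => ENNReal.ofReal (y ^ ((∑ l ∈ Finset.Iic k, s l) - 1)))
    fun k => (measurable_id.pow_const _).ennreal_ofReal

/-! ### «Converges precisely when all partial sums are positive» -/

/-- **The convergent case, with its value** (`∫⁻` form of the companion's `integral_heppCube_monomial`): if every chain partial
sum `S_k = Σ_{l≤k} s_l` is positive, `∫⁻_{0 < a_0 ≤ ⋯ ≤ a_m ≤ 1} ∏_l a_l^{s_l−1} da = ∏_k 1/S_k` ("= 1/(sdc(G^σ_1)⋯sdc(G^σ_{N−1}))").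
[cite: Panzer2022, §2.2 p. 42 (display before Proposition 2.9)] -/
theorem lintegral_heppCube_monomial (s : Fin (m + 1) → ℝ) (hs : ∀ k : Fin (m + 1), 0 < ∑ l ∈ Finset.Iic k, s l) :
    ∫⁻ a in heppCube m, ENNReal.ofReal (∏ l, a l ^ (s l - 1)) =
      ENNReal.ofReal (∏ k : Fin (m + 1), (∑ l ∈ Finset.Iic k, s l)⁻¹) := by
  rw [lintegral_heppCube_monomial_eq_prod, ENNReal.ofReal_prod_of_nonneg fun k _ => (inv_pos.2 (hs k)).le]
  exact Finset.prod_congr rfl fun k _ => lintegral_unitIoc_rpow_sub_one_of_pos (hs k)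

/-- **The divergent case**: if SOME chain partial sum `S_k = Σ_{l≤k} s_l` is `≤ 0`, the Hepp-sector integral of the monomial is
`+∞` — the contrapositive half of "This integral converges precisely when all real parts … > 0 are positive".
[cite: Panzer2022, §2.2 p. 42 (sentence before Proposition 2.9)] -/
theorem lintegral_heppCube_monomial_eq_top (s : Fin (m + 1) → ℝ) {k : Fin (m + 1)}
    (hk : ∑ l ∈ Finset.Iic k, s l ≤ 0) :
    ∫⁻ a in heppCube m, ENNReal.ofReal (∏ l, a l ^ (s l - 1)) = ∞ := by
  have hne : ∀ j : Fin (m + 1), ∫⁻ y in Ioc (0 : ℝ) 1, ENNReal.ofReal (y ^ ((∑ l ∈ Finset.Iic j, s l) - 1)) ≠ 0 := by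
    intro j
    by_cases h : 0 < ∑ l ∈ Finset.Iic j, s l
    · rw [lintegral_unitIoc_rpow_sub_one_of_pos h]
      exact (ENNReal.ofReal_pos.2 (inv_pos.2 h)).ne'
    · rw [lintegral_unitIoc_rpow_sub_one_eq_top (not_lt.1 h)]
      exact ENNReal.top_ne_zero
  rw [lintegral_heppCube_monomial_eq_prod, ← Finset.mul_prod_erase Finset.univ _ (Finset.mem_univ k),
    lintegral_unitIoc_rpow_sub_one_eq_top hk]
  exact ENNReal.top_mul (Finset.prod_ne_zero_iff.2 fun j _ => hne j)

/-- **Panzer's "converges precisely when"**, `∫⁻` form: the Hepp-sector integral of `∏_l a_l^{s_l−1}` is finite iff every chain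
partial sum `Σ_{l≤k} s_l` (`k = 0,…,m`) is positive. [cite: Panzer2022, §2.2 p. 42 (sentence before Proposition 2.9); Proposition 2.9] -/
theorem lintegral_heppCube_monomial_lt_top_iff (s : Fin (m + 1) → ℝ) :
    ∫⁻ a in heppCube m, ENNReal.ofReal (∏ l, a l ^ (s l - 1)) < ∞ ↔ ∀ k : Fin (m + 1), 0 < ∑ l ∈ Finset.Iic k, s l := by
  refine ⟨fun h k => ?_, fun h => ?_⟩
  · by_contra hk
    exact h.ne (lintegral_heppCube_monomial_eq_top s (not_lt.1 hk))
  · rw [lintegral_heppCube_monomial s h]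
    exact ENNReal.ofReal_lt_top

/-- The sector monomial is measurable (private helper: needed to pass between `∫⁻` and `IntegrableOn`). [folklore] -/
private theorem measurable_heppMonomial (s : Fin (m + 1) → ℝ) :
    Measurable fun a : Fin (m + 1) → ℝ => ∏ l, a l ^ (s l - 1) :=
  Finset.measurable_prod _ fun l _ => (measurable_pi_apply l).pow_const _

/-- **Panzer's "converges precisely when"**, Bochner form: `a ↦ ∏_l a_l^{s_l−1}` is integrable on the Hepp sector
`{0 < a_0 ≤ ⋯ ≤ a_m ≤ 1}` iff every chain partial sum `Σ_{l≤k} s_l` is positive (and then its integral is `∏_k (Σ_{l≤k} s_l)⁻¹`,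
`integral_heppCube_monomial`). [cite: Panzer2022, §2.2 p. 42 (sentence before Proposition 2.9); Proposition 2.9] -/
theorem integrableOn_heppCube_monomial_iff (s : Fin (m + 1) → ℝ) :
    IntegrableOn (fun a : Fin (m + 1) → ℝ => ∏ l, a l ^ (s l - 1)) (heppCube m) ↔
      ∀ k : Fin (m + 1), 0 < ∑ l ∈ Finset.Iic k, s l := by
  have hnn : 0 ≤ᵐ[volume.restrict (heppCube m)] fun a : Fin (m + 1) → ℝ => ∏ l, a l ^ (s l - 1) :=
    (ae_restrict_iff' measurableSet_heppCube).2
      (ae_of_all _ fun a ha => Finset.prod_nonneg fun l _ => Real.rpow_nonneg (ha.1.1 l).le _)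
  rw [← lintegral_heppCube_monomial_lt_top_iff, IntegrableOn, Integrable, hasFiniteIntegral_iff_ofReal hnn,
    and_iff_right (measurable_heppMonomial s).aestronglyMeasurable]

end Literature.MathematicalPhysics.QuantumFieldTheory.Borinsky2020
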